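import Mathlib
import Summits.ValiantsHypothesis.ValiantsHypothesis.Theorems.BarrierLeverPartitionMinorsHitByVPSimplexJoinThreeLiveA

/-!
# Route BarrierLever — item `PartitionMinorsHitByVP` (19717): `Stmt.pieceKillMany`, three live slots — patterns (1,0,0) and (1,1,0)
Helper file (`--supports stmt-ValiantsHypothesis-19717`; cell valiant-natproofs, 𝒟-side door (c), line `hidden_states`, uniform-menu
lane; prover seat val-np-p3 gen 12). Definition-free; closes NO item. The last two k = 3 shallow patterns of the case map toward
`Stmt.pieceKillMany H₀` (memo val-np-p3 g12 §2(j)), on `leaf3_allSmall` (p637800). With `q = ⌊√(2s₁)⌋` (slot 1 is deep at level 2 inside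
`a = q − 1`):
* **`pieceKill3_p100`** — levels (1,0,0) (`h+1 ≤ s₁ < 1+h+C(h,2)`, `1 ≤ s₃ ≤ s₂ ≤ h`): leaves (1,1,0)@`s₂−1` [`24n ≤ (s₂−4)⁴`], (1,1,1)@`s₃−1`
  [`120n ≤ (s₃−5)⁵`], (2,0,0)@`q−1` [`24n ≤ (q−4)⁴`]; `cover100` (`h ≥ 2^80`);
* **`pieceKill3_p110`** — levels (1,1,0) (`h+1 ≤ s₂ ≤ s₁ < 1+h+C(h,2)`, `1 ≤ s₃ ≤ h`): leaves (2,1,0)@`q−1` [`120n ≤ (q−5)⁵`], (1,1,1)@`s₃−1`,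
  and (2,1,1)@`q−1` [`720n ≤ (q−6)⁶`] when `q ≤ s₃`, else (2,1,1)@`s₃−1` [`720n ≤ (s₃−6)⁶`]; `cover110a/b` (`h ≥ 2^120`).
So all k = 3 shallow patterns are in the kernel; remaining for `Stmt.pieceKillMany`: k = 4 ((0⁴),(1,0³)), k = 5 ((0⁵)), and the dispatch.
-/

set_option linter.dupNamespace false

namespace Summit.ValiantsHypothesis.ValiantsHypothesis.Theorems.BarrierLever.SimplexJoin

open Finset Matrix

/-! ## Arithmetic helpers -/

/-- `6561·(q+1)⁴ ≤ 10⁴·(q−4)⁴` for `q ≥ 49`. -/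
theorem pow_ratio4 (q : ℕ) (hq : 49 ≤ q) : 6561 * (((q + 1) * (q + 1)) * ((q + 1) * (q + 1))) ≤ 10000 * (q - 4) ^ 4 := by
  have h1 : 9 * (q + 1) ≤ 10 * (q - 4) := by omega
  have h2 := Nat.pow_le_pow_left h1 4
  have h3 : (9 * (q + 1)) ^ 4 = 6561 * (((q + 1) * (q + 1)) * ((q + 1) * (q + 1))) := by ring
  have h4 : (10 * (q - 4)) ^ 4 = 10000 * (q - 4) ^ 4 := by ring
  rw [h3, h4] at h2; exact h2

/-- `531441·(q+1)⁶ ≤ 10⁶·(q−6)⁶` for `q ≥ 69`. -/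
theorem pow_ratio6 (q : ℕ) (hq : 69 ≤ q) :
    531441 * (((q + 1) * (q + 1)) * ((q + 1) * (q + 1)) * ((q + 1) * (q + 1))) ≤ 1000000 * (q - 6) ^ 6 := by
  have h1 : 9 * (q + 1) ≤ 10 * (q - 6) := by omega
  have h2 := Nat.pow_le_pow_left h1 6
  have h3 : (9 * (q + 1)) ^ 6 = 531441 * (((q + 1) * (q + 1)) * ((q + 1) * (q + 1)) * ((q + 1) * (q + 1))) := by ring
  have h4 : (10 * (q - 6)) ^ 6 = 1000000 * (q - 6) ^ 6 := by ring
  rw [h3, h4] at h2; exact h2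

/-- `59049²·(q+1)¹⁰ ≤ 10¹⁰·((q−5)⁵)²` for `q ≥ 59`. -/
theorem pow_ratio10 (q : ℕ) (hq : 59 ≤ q) :
    3486784401 * (((q + 1) * (q + 1)) ^ 5) ≤ 10000000000 * ((q - 5) ^ 5 * (q - 5) ^ 5) := by
  have h1 : 9 * (q + 1) ≤ 10 * (q - 5) := by omega
  have h2 := Nat.pow_le_pow_left h1 10
  have h3 : (9 * (q + 1)) ^ 10 = 3486784401 * (((q + 1) * (q + 1)) ^ 5) := by ring
  have h4 : (10 * (q - 5)) ^ 10 = 10000000000 * ((q - 5) ^ 5 * (q - 5) ^ 5) := by ring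
  rw [h3, h4] at h2; exact h2

/-- `X ≥ 10 ⇒ X⁴ ≤ 16 (X−5)⁴`; `X ≥ 13 ⇒ X⁵ ≤ 32 (X−6)⁵`; `X ≥ 14 ⇒ X⁶ ≤ 64 (X−7)⁶`. -/
theorem pow_shift4 (X : ℕ) (hX : 10 ≤ X) : X ^ 4 ≤ 16 * (X - 5) ^ 4 := by
  calc X ^ 4 ≤ (2 * (X - 5)) ^ 4 := Nat.pow_le_pow_left (by omega) 4
    _ = 16 * (X - 5) ^ 4 := by ring

/-- See `pow_shift4`. -/
theorem pow_shift5 (X : ℕ) (hX : 13 ≤ X) : X ^ 5 ≤ 32 * (X - 6) ^ 5 := by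
  calc X ^ 5 ≤ (2 * (X - 6)) ^ 5 := Nat.pow_le_pow_left (by omega) 5
    _ = 32 * (X - 6) ^ 5 := by ring

/-- See `pow_shift4`. -/
theorem pow_shift6 (X : ℕ) (hX : 14 ≤ X) : X ^ 6 ≤ 64 * (X - 7) ^ 6 := by
  calc X ^ 6 ≤ (2 * (X - 7)) ^ 6 := Nat.pow_le_pow_left (by omega) 6
    _ = 64 * (X - 7) ^ 6 := by ring

/-- From `X⁴ < K·X²·Y²` get `X < k·Y` whenever `K ≤ k²`. -/
theorem lt_mul_of_pow4 (X Y K k : ℕ) (hKk : K ≤ k * k) (h : X ^ 4 < K * (X * X * (Y * Y))) : X < k * Y := by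
  have h1 : X * X * (X * X) < X * X * (K * (Y * Y)) := by linarith [h, show X ^ 4 = X * X * (X * X) by ring]
  have h2 : X * X < K * (Y * Y) := Nat.lt_of_mul_lt_mul_left h1
  have h3 : X * X < (k * Y) * (k * Y) := by
    have := Nat.mul_le_mul_right (Y * Y) hKk
    linarith [h2, this, show k * k * (Y * Y) = (k * Y) * (k * Y) by ring]
  exact Nat.mul_self_lt_mul_self_iff.mp h3

/-! ## Pattern (1,0,0) -/

/-- Cover of pattern (1,0,0) (`h ≥ 2^80`): the three leaf inequalities cannot all fail. -/
theorem cover100 (h s₁ s₂ s₃ n q : ℕ) (hh : 2 ^ 80 ≤ h) (hs₁ : h + 1 ≤ s₁)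
    (hn : n = (s₁ + 1) * (s₂ + 1) * (s₃ + 1)) (hq2 : 2 * s₁ < (q + 1) * (q + 1))
    (hA : (s₂ - 1 + 1 - 4) ^ 4 < 24 * n) (hB : (s₃ - 1 + 1 - 5) ^ 5 < 120 * n) (hF : (q - 1 + 1 - 4) ^ 4 < 24 * n) : False := by
  have hq49 : 2 ^ 10 ≤ q := sqrt_lb q s₁ hq2 (by omega)
  set Z := s₁ + 1 with hZ
  set X := s₂ + 1 with hX
  set Y := s₃ + 1 with hY
  have hZpos : 0 < Z := by omega
  have hXpos : 0 < X := by omega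
  rw [show s₂ - 1 + 1 - 4 = X - 5 by omega] at hA
  rw [show s₃ - 1 + 1 - 5 = Y - 6 by omega] at hB
  rw [show q - 1 + 1 - 4 = q - 4 by omega] at hF
  -- Step F: `Z ≤ 37 X Y`
  have hZP : Z ≤ (q + 1) * (q + 1) := by omega
  have hZXY : Z ≤ 37 * X * Y := by
    have h1 : 6561 * (Z * Z) ≤ 6561 * (((q + 1) * (q + 1)) * ((q + 1) * (q + 1))) :=
      Nat.mul_le_mul_left _ (Nat.mul_le_mul hZP hZP)
    have h2 := pow_ratio4 q (by omega)
    have h3 : 10000 * (q - 4) ^ 4 < 10000 * (24 * n) := Nat.mul_lt_mul_of_pos_left hF (by norm_num)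
    have h4 : 6561 * (Z * Z) < 240000 * n := by omega
    rw [hn] at h4
    have h5 : Z * (6561 * Z) < Z * (240000 * (X * Y)) := by
      linarith [h4, show Z * (6561 * Z) = 6561 * (Z * Z) by ring, show Z * (240000 * (X * Y)) = 240000 * (Z * X * Y) by ring]
    have h6 := Nat.lt_of_mul_lt_mul_left h5
    linarith [h6, show 37 * X * Y = 37 * (X * Y) by ring]
  have hnb : n ≤ 37 * X * Y * X * Y := by
    have := Nat.mul_le_mul_right (X * Y) hZXY
    rw [hn]; linarith [this, show Z * X * Y = Z * (X * Y) by ring, show 37 * X * Y * (X * Y) = 37 * X * Y * X * Y by ring]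
  -- Step A: `X < 120 Y`
  have hXY : X < 120 * Y := by
    rcases lt_or_ge X 10 with hs | hb
    · omega
    · have h1 := pow_shift4 X hb
      have h2 : X ^ 4 < 16 * (24 * (37 * X * Y * X * Y)) := by
        calc X ^ 4 ≤ 16 * (X - 5) ^ 4 := h1
          _ < 16 * (24 * n) := by linarith [hA]
          _ ≤ 16 * (24 * (37 * X * Y * X * Y)) := by linarith [hnb]
      exact lt_mul_of_pow4 X Y 14208 120 (by norm_num)
        (by rw [show 14208 * (X * X * (Y * Y)) = 16 * (24 * (37 * X * Y * X * Y)) by ring]; exact h2)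
  -- Step B: `Y ≤ 2046000000`
  have hYb : Y ≤ 2046000000 := by
    rcases lt_or_ge Y 13 with hs | hb
    · omega
    · have h1 := pow_shift5 Y hb
      have hYpos : 0 < Y := by omega
      have h2 : Y ^ 5 < 32 * (120 * (37 * X * Y * X * Y)) := by
        calc Y ^ 5 ≤ 32 * (Y - 6) ^ 5 := h1
          _ < 32 * (120 * n) := by linarith [hB]
          _ ≤ 32 * (120 * (37 * X * Y * X * Y)) := by linarith [hnb]
      have h3 : X * X ≤ 120 * Y * (120 * Y) := Nat.mul_le_mul hXY.le hXY.le
      have h3' := Nat.mul_le_mul_right (Y * Y) h3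
      have h4 : Y ^ 5 < 2045952000 * (Y * Y * (Y * Y)) := by
        linarith [h2, h3', show 32 * (120 * (37 * X * Y * X * Y)) = 142080 * (X * X * (Y * Y)) by ring,
          show 120 * Y * (120 * Y) * (Y * Y) = 14400 * (Y * Y * (Y * Y)) by ring]
      have h5 : (Y * Y * (Y * Y)) * Y < (Y * Y * (Y * Y)) * 2045952000 := by
        linarith [h4, show Y ^ 5 = (Y * Y * (Y * Y)) * Y by ring, show 2045952000 * (Y * Y * (Y * Y)) = (Y * Y * (Y * Y)) * 2045952000 by ring]
      have h8 := Nat.lt_of_mul_lt_mul_left h5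
      omega
  -- contradiction: `Z ≤ 37 X Y`, `X < 120 Y`, `Y ≤ 2.05e9`, but `Z ≥ h + 2 ≥ 2^80`
  have h1 : X * Y ≤ 120 * 2046000000 * 2046000000 := by
    calc X * Y ≤ 120 * Y * Y := Nat.mul_le_mul_right _ hXY.le
      _ ≤ 120 * 2046000000 * 2046000000 := Nat.mul_le_mul (Nat.mul_le_mul_left _ hYb) hYb
  have h2 : Z ≤ 37 * (X * Y) := by rw [← mul_assoc]; exact hZXY
  omega

/-- **Pattern (1,0,0), three live slots** (`h ≥ 2^80`). -/
theorem pieceKill3_p100 {D N n : ℕ} (h : ℕ) (hh : 2 ^ 80 ≤ h) (S : Fin 1 → Fin D → Finset (Fin N))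
    (e : Fin n → Fin 1 × (Fin D → Option (Fin N))) (he : Function.Injective e)
    (hlive : ∀ c : Fin 1 × (Fin D → Option (Fin N)),
      c ∈ Set.range e ↔ ∀ (f : Fin D) (j : Fin N), c.2 f = some j → j ∈ S c.1 f)
    (f₁ f₂ f₃ : Fin D) (h12 : f₁ ≠ f₂) (h13 : f₁ ≠ f₃) (h23 : f₂ ≠ f₃)
    (hs₁ : h + 1 ≤ (S 0 f₁).card) (hs₁c : (S 0 f₁).card < ∑ i ∈ Finset.range 3, h.choose i)
    (hs₂h : (S 0 f₂).card ≤ h) (hs₃₂ : (S 0 f₃).card ≤ (S 0 f₂).card) (hs₃ : 1 ≤ (S 0 f₃).card)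
    (hn : n = ((S 0 f₁).card + 1) * ((S 0 f₂).card + 1) * ((S 0 f₃).card + 1)) :
    ∃ v : Fin n → Finset (Fin h), Function.Injective v ∧
      ∀ T : Fin 1 → Option (Fin D × Fin N) → Fin h → ℂ,
        (Matrix.of fun x x' : Fin n => ∏ a ∈ v x,
          (T (e x').1 none a + ∑ f : Fin D, ((e x').2 f).elim 0 fun j => T (e x').1 (some (f, j)) a)).det = 0 := by
  classical
  set s₁ := (S 0 f₁).card with hs₁def
  set s₂ := (S 0 f₂).card with hs₂def
  set s₃ := (S 0 f₃).card with hs₃def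
  have hc₂ : 2 * ∑ i ∈ Finset.range 3, h.choose i = h * h + h + 2 := by
    have h1 := Nat.descFactorial_eq_factorial_mul_choose h 2
    have h2 : h.descFactorial 2 = (h - 1) * h := by simp [Nat.descFactorial_succ]
    simp only [Nat.factorial_two] at h1
    simp only [Finset.sum_range_succ, Finset.sum_range_zero, Nat.choose_zero_right, Nat.choose_one_right, zero_add]
    obtain ⟨k, rfl⟩ : ∃ k, h = k + 1 := ⟨h - 1, by omega⟩
    rw [show k + 1 - 1 = k by omega] at h2
    nlinarith [h1, h2]
  obtain ⟨q, hq1, hq2⟩ : ∃ q, q * q ≤ 2 * s₁ ∧ 2 * s₁ < (q + 1) * (q + 1) :=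
    ⟨Nat.sqrt (2 * s₁), Nat.sqrt_le _, Nat.lt_succ_sqrt _⟩
  have hqh : q ≤ h := by
    have : q * q < (h + 1) * (h + 1) := by nlinarith
    exact Nat.lt_succ_iff.mp (Nat.mul_self_lt_mul_self_iff.mp this)
  by_cases hA : 24 * n ≤ (s₂ - 1 + 1 - 4) ^ 4
  · obtain ⟨hnC, hn2⟩ := n_le_of_factorial_mul_le n (s₂ - 1) 4 4 le_rfl (by rw [show Nat.factorial 4 = 24 by rfl]; exact hA)
    refine leaf3_allSmall h 1 1 0 (s₂ - 1) S e he hlive f₁ f₂ f₃ h12 h13 h23 (by omega) hn2 hnC ?_ ?_ ?_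
    · simp [Finset.sum_range_succ]; omega
    · simp [Finset.sum_range_succ]; omega
    · simp only [zero_add, Finset.sum_range_one, Nat.choose_zero_right]; omega
  by_cases hB : 120 * n ≤ (s₃ - 1 + 1 - 5) ^ 5
  · obtain ⟨hnC, hn2⟩ := n_le_of_factorial_mul_le n (s₃ - 1) 5 5 le_rfl (by rw [show Nat.factorial 5 = 120 by rfl]; exact hB)
    refine leaf3_allSmall h 1 1 1 (s₃ - 1) S e he hlive f₁ f₂ f₃ h12 h13 h23 (by omega) hn2 hnC ?_ ?_ ?_
    · simp [Finset.sum_range_succ]; omega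
    · simp [Finset.sum_range_succ]; omega
    · simp [Finset.sum_range_succ]; omega
  by_cases hF : 24 * n ≤ (q - 1 + 1 - 4) ^ 4
  · obtain ⟨hnC, hn2⟩ := n_le_of_factorial_mul_le n (q - 1) 4 4 le_rfl (by rw [show Nat.factorial 4 = 24 by rfl]; exact hF)
    have hq10 : 2 ^ 10 ≤ q := sqrt_lb q s₁ hq2 (by omega)
    refine leaf3_allSmall h 2 0 0 (q - 1) S e he hlive f₁ f₂ f₃ h12 h13 h23 (by omega) hn2 hnC ?_ ?_ ?_
    · exact sum_choose_three_le_of_sq (q - 1) s₁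
        (lev2_of_sq (q - 1) s₁ (by rw [show q - 1 + 1 = q by omega]; exact hq1) (by omega))
    · simp only [zero_add, Finset.sum_range_one, Nat.choose_zero_right]; omega
    · simp only [zero_add, Finset.sum_range_one, Nat.choose_zero_right]; omega
  exact (cover100 h s₁ s₂ s₃ n q hh hs₁ hn hq2 (not_le.mp hA) (not_le.mp hB) (not_le.mp hF)).elim

/-! ## Pattern (1,1,0) -/

/-- Cover of pattern (1,1,0), case `q ≤ s₃` (`h ≥ 2^40`): leaves (2,1,1)@`q−1` and (1,1,1)@`s₃−1` cannot both fail. -/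
theorem cover110a (h s₁ s₂ s₃ n q : ℕ) (hh : 2 ^ 40 ≤ h) (hs₂ : h + 1 ≤ s₂) (hs₂₁ : s₂ ≤ s₁)
    (hn : n = (s₁ + 1) * (s₂ + 1) * (s₃ + 1)) (hq2 : 2 * s₁ < (q + 1) * (q + 1)) (hqs : q ≤ s₃)
    (hB : (s₃ - 1 + 1 - 5) ^ 5 < 120 * n) (hF2 : (q - 1 + 1 - 6) ^ 6 < 720 * n) : False := by
  have hq49 : 2 ^ 10 ≤ q := sqrt_lb q s₁ hq2 (by omega)
  set Z := s₁ + 1 with hZ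
  set X := s₂ + 1 with hX
  set Y := s₃ + 1 with hY
  have hZpos : 0 < Z := by omega
  have hYpos : 0 < Y := by omega
  rw [show s₃ - 1 + 1 - 5 = Y - 6 by omega] at hB
  rw [show q - 1 + 1 - 6 = q - 6 by omega] at hF2
  have hXZ : X ≤ Z := by omega
  have hZP : Z ≤ (q + 1) * (q + 1) := by omega
  -- `Z < 1355 Y`
  have hZY : Z < 1355 * Y := by
    have h1 : 531441 * (Z * Z * Z) ≤ 531441 * (((q + 1) * (q + 1)) * ((q + 1) * (q + 1)) * ((q + 1) * (q + 1))) :=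
      Nat.mul_le_mul_left _ (Nat.mul_le_mul (Nat.mul_le_mul hZP hZP) hZP)
    have h2 := pow_ratio6 q (by omega)
    have h3 : 1000000 * (q - 6) ^ 6 < 1000000 * (720 * n) := Nat.mul_lt_mul_of_pos_left hF2 (by norm_num)
    have h4 : 531441 * (Z * Z * Z) < 720000000 * n := by omega
    rw [hn] at h4
    have hprod : 720000000 * (Z * X * Y) ≤ 720000000 * (Z * Z * Y) :=
      Nat.mul_le_mul_left _ (Nat.mul_le_mul_right Y (Nat.mul_le_mul_left Z hXZ))
    have h5 : 531441 * (Z * Z * Z) < 720000000 * (Z * Z * Y) := h4.trans_le hprod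
    have h6 : Z * Z * (531441 * Z) < Z * Z * (720000000 * Y) := by
      linarith [h5, show Z * Z * (531441 * Z) = 531441 * (Z * Z * Z) by ring, show Z * Z * (720000000 * Y) = 720000000 * (Z * Z * Y) by ring]
    have h7 := Nat.lt_of_mul_lt_mul_left h6
    omega
  -- `Y ≤ 84000`
  have hYb : Y ≤ 84000 := by
    rcases lt_or_ge Y 13 with hs | hb
    · omega
    · have h1 := pow_shift5 Y hb
      have hprod : 32 * (120 * (Z * X * Y)) ≤ 32 * (120 * (Z * Z * Y)) :=
        Nat.mul_le_mul_left _ (Nat.mul_le_mul_left _ (Nat.mul_le_mul_right Y (Nat.mul_le_mul_left Z hXZ)))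
      have h2 : Y ^ 5 < 32 * (120 * (Z * Z * Y)) := by
        calc Y ^ 5 ≤ 32 * (Y - 6) ^ 5 := h1
          _ < 32 * (120 * n) := by linarith [hB]
          _ ≤ 32 * (120 * (Z * Z * Y)) := by rw [hn]; exact hprod
      have h3 : Z * Z ≤ 1355 * Y * (1355 * Y) := Nat.mul_le_mul hZY.le hZY.le
      have h3' := Nat.mul_le_mul_right Y h3
      have h4 : Y * (Y * Y * Y * Y) < Y * (7050336000 * (Y * Y)) := by
        linarith [h2, h3', show Y ^ 5 = Y * (Y * Y * Y * Y) by ring, show 32 * (120 * (Z * Z * Y)) = 3840 * (Z * Z * Y) by ring,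
          show 1355 * Y * (1355 * Y) * Y = Y * (1836025 * (Y * Y)) by ring]
      have h5 := Nat.lt_of_mul_lt_mul_left h4
      have h6 : Y * Y * (Y * Y) < Y * Y * 7050336000 := by
        linarith [h5, show Y * Y * Y * Y = Y * Y * (Y * Y) by ring]
      have h7 := Nat.lt_of_mul_lt_mul_left h6
      have : Y * Y < 84000 * 84000 := by omega
      exact (Nat.mul_self_lt_mul_self_iff.mp this).le
  have : Z < 1355 * 84000 := hZY.trans_le (Nat.mul_le_mul_left _ hYb)
  omega

/-- Cover of pattern (1,1,0), case `s₃ < q` (`h ≥ 2^120`): leaves (2,1,0)@`q−1` and (2,1,1)@`s₃−1` cannot both fail. -/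
theorem cover110b (h s₁ s₂ s₃ n q : ℕ) (hh : 2 ^ 120 ≤ h) (hs₂ : h + 1 ≤ s₂) (hs₂₁ : s₂ ≤ s₁)
    (hn : n = (s₁ + 1) * (s₂ + 1) * (s₃ + 1)) (hq2 : 2 * s₁ < (q + 1) * (q + 1))
    (hF1 : (q - 1 + 1 - 5) ^ 5 < 120 * n) (hB3 : (s₃ - 1 + 1 - 6) ^ 6 < 720 * n) : False := by
  have hq49 : 2 ^ 10 ≤ q := sqrt_lb q s₁ hq2 (by omega)
  set Z := s₁ + 1 with hZ
  set X := s₂ + 1 with hX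
  set Y := s₃ + 1 with hY
  have hZpos : 0 < Z := by omega
  have hYpos : 0 < Y := by omega
  rw [show q - 1 + 1 - 5 = q - 5 by omega] at hF1
  rw [show s₃ - 1 + 1 - 6 = Y - 7 by omega] at hB3
  have hXZ : X ≤ Z := by omega
  have hZP : Z ≤ (q + 1) * (q + 1) := by omega
  -- Step F1 (squared): `Z³ < 41300 X² Y² ≤ 41300 Z² Y²`, so `Z < 41300 Y²`
  have hZY2 : Z < 41300 * (Y * Y) := by
    have h1 : 3486784401 * (Z ^ 5) ≤ 3486784401 * (((q + 1) * (q + 1)) ^ 5) :=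
      Nat.mul_le_mul_left _ (Nat.pow_le_pow_left hZP 5)
    have h2 := pow_ratio10 q (by omega)
    have h3 : (q - 5) ^ 5 * (q - 5) ^ 5 < (120 * n) * (120 * n) := Nat.mul_lt_mul'' hF1 hF1
    have h4 : 10000000000 * ((q - 5) ^ 5 * (q - 5) ^ 5) < 10000000000 * ((120 * n) * (120 * n)) :=
      Nat.mul_lt_mul_of_pos_left h3 (by norm_num)
    have h5 : 3486784401 * Z ^ 5 < 144000000000000 * (n * n) := by
      linarith [h1, h2, h4, show 10000000000 * ((120 * n) * (120 * n)) = 144000000000000 * (n * n) by ring]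
    have h6 : n ≤ Z * Z * Y := by rw [hn]; exact Nat.mul_le_mul_right Y (Nat.mul_le_mul_left Z hXZ)
    have h7 : n * n ≤ (Z * Z * Y) * (Z * Z * Y) := Nat.mul_le_mul h6 h6
    have h8 : 3486784401 * Z ^ 5 < 144000000000000 * ((Z * Z * Y) * (Z * Z * Y)) := by
      have := Nat.mul_le_mul_left 144000000000000 h7
      linarith [h5, this]
    have h9 : Z ^ 4 * (3486784401 * Z) < Z ^ 4 * (144000000000000 * (Y * Y)) := by
      linarith [h8, show Z ^ 4 * (3486784401 * Z) = 3486784401 * Z ^ 5 by ring,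
        show Z ^ 4 * (144000000000000 * (Y * Y)) = 144000000000000 * ((Z * Z * Y) * (Z * Z * Y)) by ring]
    have h10 := Nat.lt_of_mul_lt_mul_left h9
    omega
  rcases lt_or_ge Y 14 with hs | hb
  · have : Z < 41300 * (14 * 14) := hZY2.trans_le (Nat.mul_le_mul_left _ (Nat.mul_le_mul hs.le hs.le))
    omega
  · -- Step B3: `Y⁵ < 46080 Z²`; with `Z < 41300 Y²`: `Y < 7.86e13`, then `Z < 2^110`
    have h1 := pow_shift6 Y hb
    have hprod : 64 * (720 * (Z * X * Y)) ≤ 64 * (720 * (Z * Z * Y)) :=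
      Nat.mul_le_mul_left _ (Nat.mul_le_mul_left _ (Nat.mul_le_mul_right Y (Nat.mul_le_mul_left Z hXZ)))
    have h2 : Y ^ 6 < 64 * (720 * (Z * Z * Y)) := by
      calc Y ^ 6 ≤ 64 * (Y - 7) ^ 6 := h1
        _ < 64 * (720 * n) := by linarith [hB3]
        _ ≤ 64 * (720 * (Z * Z * Y)) := by rw [hn]; exact hprod
    have h3 : Y * (Y ^ 5) < Y * (46080 * (Z * Z)) := by
      linarith [h2, show Y ^ 6 = Y * Y ^ 5 by ring, show 64 * (720 * (Z * Z * Y)) = Y * (46080 * (Z * Z)) by ring]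
    have h4 := Nat.lt_of_mul_lt_mul_left h3
    have h5 : Z * Z ≤ 41300 * (Y * Y) * (41300 * (Y * Y)) := Nat.mul_le_mul hZY2.le hZY2.le
    have h6 : Y ^ 5 < 78598195200000 * (Y * Y * (Y * Y)) := by
      have := Nat.mul_le_mul_left 46080 h5
      linarith [h4, this, show 46080 * (41300 * (Y * Y) * (41300 * (Y * Y))) = 78598195200000 * (Y * Y * (Y * Y)) by ring]
    have h7 : (Y * Y * (Y * Y)) * Y < (Y * Y * (Y * Y)) * 78598195200000 := by
      linarith [h6, show Y ^ 5 = (Y * Y * (Y * Y)) * Y by ring,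
        show 78598195200000 * (Y * Y * (Y * Y)) = (Y * Y * (Y * Y)) * 78598195200000 by ring]
    have h8 := Nat.lt_of_mul_lt_mul_left h7
    have h9 : Y * Y ≤ 78598195200000 * 78598195200000 := Nat.mul_le_mul h8.le h8.le
    have h10 : Z < 41300 * (78598195200000 * 78598195200000) := hZY2.trans_le (Nat.mul_le_mul_left _ h9)
    omega

/-- **Pattern (1,1,0), three live slots** (`h ≥ 2^120`). -/
theorem pieceKill3_p110 {D N n : ℕ} (h : ℕ) (hh : 2 ^ 120 ≤ h) (S : Fin 1 → Fin D → Finset (Fin N))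
    (e : Fin n → Fin 1 × (Fin D → Option (Fin N))) (he : Function.Injective e)
    (hlive : ∀ c : Fin 1 × (Fin D → Option (Fin N)),
      c ∈ Set.range e ↔ ∀ (f : Fin D) (j : Fin N), c.2 f = some j → j ∈ S c.1 f)
    (f₁ f₂ f₃ : Fin D) (h12 : f₁ ≠ f₂) (h13 : f₁ ≠ f₃) (h23 : f₂ ≠ f₃)
    (hs₁c : (S 0 f₁).card < ∑ i ∈ Finset.range 3, h.choose i) (hs₂ : h + 1 ≤ (S 0 f₂).card)
    (hs₂₁ : (S 0 f₂).card ≤ (S 0 f₁).card) (hs₃h : (S 0 f₃).card ≤ h) (hs₃ : 1 ≤ (S 0 f₃).card)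
    (hn : n = ((S 0 f₁).card + 1) * ((S 0 f₂).card + 1) * ((S 0 f₃).card + 1)) :
    ∃ v : Fin n → Finset (Fin h), Function.Injective v ∧
      ∀ T : Fin 1 → Option (Fin D × Fin N) → Fin h → ℂ,
        (Matrix.of fun x x' : Fin n => ∏ a ∈ v x,
          (T (e x').1 none a + ∑ f : Fin D, ((e x').2 f).elim 0 fun j => T (e x').1 (some (f, j)) a)).det = 0 := by
  classical
  set s₁ := (S 0 f₁).card with hs₁def
  set s₂ := (S 0 f₂).card with hs₂def
  set s₃ := (S 0 f₃).card with hs₃def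
  have hc₂ : 2 * ∑ i ∈ Finset.range 3, h.choose i = h * h + h + 2 := by
    have h1 := Nat.descFactorial_eq_factorial_mul_choose h 2
    have h2 : h.descFactorial 2 = (h - 1) * h := by simp [Nat.descFactorial_succ]
    simp only [Nat.factorial_two] at h1
    simp only [Finset.sum_range_succ, Finset.sum_range_zero, Nat.choose_zero_right, Nat.choose_one_right, zero_add]
    obtain ⟨k, rfl⟩ : ∃ k, h = k + 1 := ⟨h - 1, by omega⟩
    rw [show k + 1 - 1 = k by omega] at h2
    nlinarith [h1, h2]
  obtain ⟨q, hq1, hq2⟩ : ∃ q, q * q ≤ 2 * s₁ ∧ 2 * s₁ < (q + 1) * (q + 1) :=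
    ⟨Nat.sqrt (2 * s₁), Nat.sqrt_le _, Nat.lt_succ_sqrt _⟩
  have hqh : q ≤ h := by
    have : q * q < (h + 1) * (h + 1) := by nlinarith
    exact Nat.lt_succ_iff.mp (Nat.mul_self_lt_mul_self_iff.mp this)
  have hq10 : 2 ^ 10 ≤ q := sqrt_lb q s₁ hq2 (by omega)
  have hlev1q : ∑ i ∈ Finset.range 3, (q - 1).choose i ≤ s₁ :=
    sum_choose_three_le_of_sq (q - 1) s₁ (lev2_of_sq (q - 1) s₁ (by rw [show q - 1 + 1 = q by omega]; exact hq1) (by omega))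
  have hlev2q : ∑ i ∈ Finset.range 2, (q - 1).choose i ≤ s₂ := by
    simp [Finset.sum_range_succ]; omega
  by_cases hF1 : 120 * n ≤ (q - 1 + 1 - 5) ^ 5
  · obtain ⟨hnC, hn2⟩ := n_le_of_factorial_mul_le n (q - 1) 5 5 le_rfl (by rw [show Nat.factorial 5 = 120 by rfl]; exact hF1)
    exact leaf3_allSmall h 2 1 0 (q - 1) S e he hlive f₁ f₂ f₃ h12 h13 h23 (by omega) hn2 hnC hlev1q hlev2q
      (by simp only [zero_add, Finset.sum_range_one, Nat.choose_zero_right]; omega)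
  by_cases hB1 : 120 * n ≤ (s₃ - 1 + 1 - 5) ^ 5
  · obtain ⟨hnC, hn2⟩ := n_le_of_factorial_mul_le n (s₃ - 1) 5 5 le_rfl (by rw [show Nat.factorial 5 = 120 by rfl]; exact hB1)
    refine leaf3_allSmall h 1 1 1 (s₃ - 1) S e he hlive f₁ f₂ f₃ h12 h13 h23 (by omega) hn2 hnC ?_ ?_ ?_
    · simp [Finset.sum_range_succ]; omega
    · simp [Finset.sum_range_succ]; omega
    · simp [Finset.sum_range_succ]; omega
  by_cases hqs : q ≤ s₃
  · by_cases hF2 : 720 * n ≤ (q - 1 + 1 - 6) ^ 6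
    · obtain ⟨hnC, hn2⟩ := n_le_of_factorial_mul_le n (q - 1) 6 6 le_rfl (by rw [show Nat.factorial 6 = 720 by rfl]; exact hF2)
      exact leaf3_allSmall h 2 1 1 (q - 1) S e he hlive f₁ f₂ f₃ h12 h13 h23 (by omega) hn2 hnC hlev1q hlev2q
        (by simp [Finset.sum_range_succ]; omega)
    exact (cover110a h s₁ s₂ s₃ n q (by omega) hs₂ hs₂₁ hn hq2 hqs (not_le.mp hB1) (not_le.mp hF2)).elim
  · push Not at hqs
    by_cases hB3 : 720 * n ≤ (s₃ - 1 + 1 - 6) ^ 6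
    · obtain ⟨hnC, hn2⟩ := n_le_of_factorial_mul_le n (s₃ - 1) 6 6 le_rfl (by rw [show Nat.factorial 6 = 720 by rfl]; exact hB3)
      refine leaf3_allSmall h 2 1 1 (s₃ - 1) S e he hlive f₁ f₂ f₃ h12 h13 h23 (by omega) hn2 hnC ?_ ?_ ?_
      · exact sum_choose_three_le_of_sq (s₃ - 1) s₁ (lev2_of_sq (s₃ - 1) s₁
          (by rw [show s₃ - 1 + 1 = s₃ by omega]; exact (Nat.mul_le_mul hqs.le hqs.le).trans hq1) (by omega))
      · simp [Finset.sum_range_succ]; omega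
      · simp [Finset.sum_range_succ]; omega
    exact (cover110b h s₁ s₂ s₃ n q hh hs₂ hs₂₁ hn hq2 (not_le.mp hF1) (not_le.mp hB3)).elim

end Summit.ValiantsHypothesis.ValiantsHypothesis.Theorems.BarrierLever.SimplexJoin
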